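import Mathlib.Analysis.Real.Pi.Bounds
import Mathlib.Analysis.Complex.ExponentialBounds
import Literature.Analysis.FluidPDE.SawtoothCascade

/-!
# K1loc — helper: RATIONAL MAJORANTS FOR THE CLOSED-FORM JUNK OF THE OSCILLATORY STEPS (numeric layer, tools)

Helper file of the prover lane on the crux `K1LocalisedCascade` (stmt-AnomalousDissipation-19491), route `SawtoothPulseCascade`
(S-B/S-C assembly seat; the LEDGER ASSEMBLY, numeric layer).  Every oscillatory class step landed by this seat
(`K1Window.lowFibre_hstep_osc_le`, `strip_vstep_osc_le`, `offCone_vstep_osc_le`, `subcone_hstep_osc_le`, `shell_vstep_osc_le`,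
`shallow_hstep_osc_le`; composed in `…PhaseStepOsc.resolved_step_osc` and `…ShellChainOsc`) leaves a junk energy of ONE shape,
  `J = 3r²·(4/3·ε² + 4/3·(2N/(πD))² + 8NA/(πD) + c·(8NA²√(4Z/(πD))) + 8A²Z/π)`,
with the zone depth `Z = max(1, √(2log(1/η)))·δ_j`, `η = ε/(A·π·8·2^p·X)·(1/64)^j`, `δ_j = δ₀/2^j`.  To CERTIFY the per-phase
numbers of the fat Osc segment (phases `j = 4, …` along `K_j = 800·25^{j−2}`) these closed forms must be bounded by rationals.
This file is the tool kit, used verbatim by every per-phase numeric file: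
* `oscJunk_le` — `J ≤` the same expression with `π ↦ 3.141592` in the denominators, `ε² ↦ e₀`, `Z ↦ Z₀` and `√(4Z/(πD)) ↦ s`
  (`4Z₀/(3.141592·D) ≤ s²`): a polynomial in rationals, decided by `norm_num` at each instance;
* `inv_rounding_target_le` — `1/η ≤ A·3.1416·8·2^p·X·64^j/ε`; `zoneDepth_mul_le` — `1/η ≤ 2^m` and `1.3862943616·m ≤ M₀²` (`M₀ ≥ 1`)
  give `max(1,√(2log(1/η)))·δ ≤ M₀·δ` (`log 2 < 0.6931471808`); `zoneDepth_lt_pi_half` — the side condition `Z < π/2` of the steps;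
* `sq_window_amplitude_le` (`(√J₁ + √J₂ + 𝔞 + √f)² ≤ (w₁ + w₂ + α + ψ)²` from the four amplitude bounds; square roots against
  rationals by `Real.sqrt_le_iff`), `CascadeParams.delta_eq_div_two_pow` / `delta_le_of_le` (`δ_j = δ₀/2^j ≤ δ*/2^j` for `d = 2`, `δ₀ ≤ δ*`).
Pure real arithmetic; no definitions; no statement about the crux. [cite: Grafakos2014, Prop. 3.2.7 (3)] [problem: turb]
-/

-- `Summit.<Summit>.<Problem>`: single-conjunct summit, the duplicate namespace segment is deliberate.
set_option linter.dupNamespace false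

noncomputable section

namespace Summit.AnomalousDissipation.AnomalousDissipation.Theorems.SawtoothPulseCascade.K1Window

open Real

/-! ## §1 Square roots and squared amplitude sums -/

/-- **Monotonicity of a squared sum of four amplitudes**: `√J₁ ≤ w₁`, `√J₂ ≤ w₂`, `𝔞 ≤ α` (`0 ≤ 𝔞`), `√f ≤ ψ` give
`(√J₁ + √J₂ + 𝔞 + √f)² ≤ (w₁ + w₂ + α + ψ)²`. [folklore] -/
theorem sq_window_amplitude_le {J₁ J₂ 𝔞 f w₁ w₂ α ψ : ℝ} (h₁ : Real.sqrt J₁ ≤ w₁) (h₂ : Real.sqrt J₂ ≤ w₂) (h𝔞0 : 0 ≤ 𝔞)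
    (h𝔞 : 𝔞 ≤ α) (hf : Real.sqrt f ≤ ψ) :
    (Real.sqrt J₁ + Real.sqrt J₂ + 𝔞 + Real.sqrt f) ^ 2 ≤ (w₁ + w₂ + α + ψ) ^ 2 :=
  pow_le_pow_left₀ (by positivity) (by linarith) 2

/-- **Monotonicity of a squared sum of three amplitudes** (the start of a shell chain: `√J₁ + √J₂ + √f`). [folklore] -/
theorem sq_window_amplitude_le₃ {J₁ J₂ f w₁ w₂ ψ : ℝ} (h₁ : Real.sqrt J₁ ≤ w₁) (h₂ : Real.sqrt J₂ ≤ w₂) (hf : Real.sqrt f ≤ ψ) :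
    (Real.sqrt J₁ + Real.sqrt J₂ + Real.sqrt f) ^ 2 ≤ (w₁ + w₂ + ψ) ^ 2 :=
  pow_le_pow_left₀ (by positivity) (by linarith) 2

/-! ## §2 The zone depth -/

/-- **The rounding target from below**: for `η = ε/(A·π·8·P·X)·(1/64)^j` with `ε > 0` and `A, P, X ≥ 0`,
`1/η ≤ A·3.1416·8·P·X·64^j/ε` (`π < 3.1416`). [folklore] -/
theorem inv_rounding_target_le {ε A Pw X : ℝ} (j : ℕ) (hε : 0 < ε) (hA : 0 ≤ A) (hPw : 0 ≤ Pw) (hX : 0 ≤ X) :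
    1 / (ε / (A * π * 8 * Pw * X) * (1 / 64) ^ j) ≤ A * 3.1416 * 8 * Pw * X * 64 ^ j / ε := by
  have hπ := Real.pi_lt_d4
  have e : 1 / (ε / (A * π * 8 * Pw * X) * (1 / 64) ^ j) = A * π * 8 * Pw * X * 64 ^ j / ε := by
    rw [one_div_pow, ← div_eq_mul_one_div, div_div, one_div_div, mul_div_assoc]
  rw [e]
  refine div_le_div_of_nonneg_right ?_ hε.le
  have h64 : (0 : ℝ) ≤ 64 ^ j := by positivity
  have : A * π * 8 * Pw * X ≤ A * 3.1416 * 8 * Pw * X := by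
    have := mul_le_mul_of_nonneg_left hπ.le hA
    nlinarith [mul_nonneg (mul_nonneg hPw hX) (sub_nonneg.2 this)]
  exact mul_le_mul_of_nonneg_right this h64

/-- **The rounding target is positive** (`ε, A, P, X > 0`). [folklore] -/
theorem rounding_target_pos {ε A Pw X : ℝ} (j : ℕ) (hε : 0 < ε) (hA : 0 < A) (hPw : 0 < Pw) (hX : 0 < X) :
    0 < ε / (A * π * 8 * Pw * X) * (1 / 64) ^ j := by
  have := Real.pi_pos
  positivity

/-- **Zone depth from a power-of-two bound on the target**: `0 < η`, `1/η ≤ 2^m`, `1 ≤ M₀`, `1.3862943616·m ≤ M₀²` give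
`max(1, √(2log(1/η))) ≤ M₀` (`log 2 < 0.6931471808`). [folklore] -/
theorem zoneDepth_le {η M₀ : ℝ} {m : ℕ} (hη : 0 < η) (h : 1 / η ≤ 2 ^ m) (hM₀ : 1 ≤ M₀) (hM : 1.3862943616 * m ≤ M₀ ^ 2) :
    max 1 (Real.sqrt (2 * Real.log (1 / η))) ≤ M₀ := by
  refine max_le hM₀ (Real.sqrt_le_iff.mpr ⟨by linarith, ?_⟩)
  have h1 : Real.log (1 / η) ≤ Real.log (2 ^ m) := Real.log_le_log (by positivity) h
  rw [Real.log_pow] at h1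
  have h2 := Real.log_two_lt_d9
  have hm : (0 : ℝ) ≤ m := Nat.cast_nonneg m
  nlinarith [mul_le_mul_of_nonneg_left h2.le hm]

/-- **Zone depth times the rounding width**: under the hypotheses of `zoneDepth_le` and `0 ≤ δ`,
`max(1, √(2log(1/η)))·δ ≤ M₀·δ`. [folklore] -/
theorem zoneDepth_mul_le {η M₀ δ : ℝ} {m : ℕ} (hη : 0 < η) (h : 1 / η ≤ 2 ^ m) (hM₀ : 1 ≤ M₀) (hM : 1.3862943616 * m ≤ M₀ ^ 2)
    (hδ : 0 ≤ δ) : max 1 (Real.sqrt (2 * Real.log (1 / η))) * δ ≤ M₀ * δ :=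
  mul_le_mul_of_nonneg_right (zoneDepth_le hη h hM₀ hM) hδ

/-- **The side condition of the oscillatory steps**: `max(1,√(2log(1/η)))·δ ≤ Z₀` and `Z₀ < 3/2` give `max(1,√(2log(1/η)))·δ < π/2`.
[folklore] -/
theorem zoneDepth_lt_pi_half {η δ Z₀ : ℝ} (h : max 1 (Real.sqrt (2 * Real.log (1 / η))) * δ ≤ Z₀) (hZ₀ : Z₀ < 3 / 2) :
    max 1 (Real.sqrt (2 * Real.log (1 / η))) * δ < π / 2 := by
  have := Real.pi_gt_three
  linarith

/-! ## §3 The junk of one oscillatory step against rationals -/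

/-- **THE OSCILLATORY JUNK AGAINST RATIONALS.**  For `D > 0`, `N, A, c ≥ 0`, `0 ≤ Z ≤ Z₀`, `ε² ≤ e₀`, `0 ≤ s` with `4Z₀/(3.141592·D) ≤ s²`:
`3r²(4/3ε² + 4/3(2N/(πD))² + 8NA/(πD) + c(8NA²√(4Z/(πD))) + 8A²Z/π)`
`≤ 3r²(4/3e₀ + 4/3(2N/(3.141592·D))² + 8NA/(3.141592·D) + c(8NA²s) + 8A²Z₀/3.141592)` (`3.141592 < π`). [folklore] -/
theorem oscJunk_le {r ε N A D c Z e₀ Z₀ s : ℝ} (hD : 0 < D) (hN : 0 ≤ N) (hA : 0 ≤ A) (hc : 0 ≤ c) (hZ0 : 0 ≤ Z) (hZ : Z ≤ Z₀)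
    (hε : ε ^ 2 ≤ e₀) (hs0 : 0 ≤ s) (hs : 4 * Z₀ / (3.141592 * D) ≤ s ^ 2) :
    3 * r ^ 2 * (4 / 3 * ε ^ 2 + 4 / 3 * (2 * N / (π * D)) ^ 2 + 8 * N * A / (π * D) +
        c * (8 * N * A ^ 2 * Real.sqrt (4 * Z / (π * D))) + 8 * A ^ 2 * Z / π) ≤
      3 * r ^ 2 * (4 / 3 * e₀ + 4 / 3 * (2 * N / (3.141592 * D)) ^ 2 + 8 * N * A / (3.141592 * D) +
        c * (8 * N * A ^ 2 * s) + 8 * A ^ 2 * Z₀ / 3.141592) := by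
  have hπ := Real.pi_gt_d6
  have hπ0 : (0 : ℝ) < 3.141592 := by norm_num
  have hπD : 3.141592 * D ≤ π * D := mul_le_mul_of_nonneg_right hπ.le hD.le
  have hπD0 : 0 < 3.141592 * D := mul_pos hπ0 hD
  -- term by term
  have t2 : 2 * N / (π * D) ≤ 2 * N / (3.141592 * D) := div_le_div_of_nonneg_left (by positivity) hπD0 hπD
  have t2' : (2 * N / (π * D)) ^ 2 ≤ (2 * N / (3.141592 * D)) ^ 2 := pow_le_pow_left₀ (by positivity) t2 2
  have t3 : 8 * N * A / (π * D) ≤ 8 * N * A / (3.141592 * D) := div_le_div_of_nonneg_left (by positivity) hπD0 hπD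
  have t4a : 4 * Z / (π * D) ≤ 4 * Z₀ / (3.141592 * D) :=
    (div_le_div_of_nonneg_left (by positivity) hπD0 hπD).trans (div_le_div_of_nonneg_right (by linarith) hπD0.le)
  have t4 : Real.sqrt (4 * Z / (π * D)) ≤ s := Real.sqrt_le_iff.mpr ⟨hs0, t4a.trans hs⟩
  have t4' : c * (8 * N * A ^ 2 * Real.sqrt (4 * Z / (π * D))) ≤ c * (8 * N * A ^ 2 * s) :=
    mul_le_mul_of_nonneg_left (mul_le_mul_of_nonneg_left t4 (by positivity)) hc
  have t5 : 8 * A ^ 2 * Z / π ≤ 8 * A ^ 2 * Z₀ / 3.141592 :=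
    (div_le_div_of_nonneg_left (by positivity) hπ0 hπ.le).trans (div_le_div_of_nonneg_right (by nlinarith [sq_nonneg A]) hπ0.le)
  have hr : 0 ≤ 3 * r ^ 2 := by positivity
  exact mul_le_mul_of_nonneg_left (by linarith) hr

/-! ## §4 The rounding width of the cascade -/

/-- `δ_j = δ₀/2^j` for `d = 2`. [folklore] -/
theorem _root_.Literature.Analysis.FluidPDE.SawtoothCascade.CascadeParams.delta_eq_div_two_pow
    (P : Literature.Analysis.FluidPDE.SawtoothCascade.CascadeParams) (hd : P.d = 2) (j : ℕ) : P.δ j = P.δ₀ / 2 ^ j := by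
  rw [Literature.Analysis.FluidPDE.SawtoothCascade.CascadeParams.δ, hd]

/-- `0 ≤ δ₀ ≤ δ*` and `d = 2` give `0 ≤ δ_j ≤ δ*/2^j`. [folklore] -/
theorem _root_.Literature.Analysis.FluidPDE.SawtoothCascade.CascadeParams.delta_le_of_le
    (P : Literature.Analysis.FluidPDE.SawtoothCascade.CascadeParams) (hd : P.d = 2) {δs : ℝ} (hδ₀ : 0 ≤ P.δ₀) (hδ₀' : P.δ₀ ≤ δs)
    (j : ℕ) : 0 ≤ P.δ j ∧ P.δ j ≤ δs / 2 ^ j := by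
  rw [P.delta_eq_div_two_pow hd]
  exact ⟨by positivity, div_le_div_of_nonneg_right hδ₀' (by positivity)⟩


/-! ## §5 The junk shape with the zone terms under the block count (the shape the landed steps actually use) -/

/-- **THE OSCILLATORY JUNK AGAINST RATIONALS, landed shape.**  In the landed steps the block count `c = M_b` multiplies BOTH zone
terms: `J = 3r²(4/3ε² + 4/3(2N/(πD))² + 8NA/(πD) + c·(8NA²√(4Z/(πD)) + 8A²Z/π))` (`…BlockJunkOsc.blockJunk_osc_sum_le`; `oscJunk_le`
above has the last term outside the bracket and is not the shape of `…PhaseStepOsc`).  For `D > 0`, `N, A, c ≥ 0`, `0 ≤ Z ≤ Z₀`,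
`ε² ≤ e₀`, `0 ≤ s`, `4Z₀/(3.141592·D) ≤ s²`:
`J ≤ 3r²(4/3e₀ + 4/3(2N/(3.141592·D))² + 8NA/(3.141592·D) + c·(8NA²s + 8A²Z₀/3.141592))`. [folklore] -/
theorem oscJunk_le' {r ε N A D c Z e₀ Z₀ s : ℝ} (hD : 0 < D) (hN : 0 ≤ N) (hA : 0 ≤ A) (hc : 0 ≤ c) (hZ0 : 0 ≤ Z) (hZ : Z ≤ Z₀)
    (hε : ε ^ 2 ≤ e₀) (hs0 : 0 ≤ s) (hs : 4 * Z₀ / (3.141592 * D) ≤ s ^ 2) :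
    3 * r ^ 2 * (4 / 3 * ε ^ 2 + 4 / 3 * (2 * N / (π * D)) ^ 2 + 8 * N * A / (π * D) +
        c * (8 * N * A ^ 2 * Real.sqrt (4 * Z / (π * D)) + 8 * A ^ 2 * Z / π)) ≤
      3 * r ^ 2 * (4 / 3 * e₀ + 4 / 3 * (2 * N / (3.141592 * D)) ^ 2 + 8 * N * A / (3.141592 * D) +
        c * (8 * N * A ^ 2 * s + 8 * A ^ 2 * Z₀ / 3.141592)) := by
  have hπ := Real.pi_gt_d6
  have hπ0 : (0 : ℝ) < 3.141592 := by norm_num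
  have hπD : 3.141592 * D ≤ π * D := mul_le_mul_of_nonneg_right hπ.le hD.le
  have hπD0 : 0 < 3.141592 * D := mul_pos hπ0 hD
  have t2 : 2 * N / (π * D) ≤ 2 * N / (3.141592 * D) := div_le_div_of_nonneg_left (by positivity) hπD0 hπD
  have t2' : (2 * N / (π * D)) ^ 2 ≤ (2 * N / (3.141592 * D)) ^ 2 := pow_le_pow_left₀ (by positivity) t2 2
  have t3 : 8 * N * A / (π * D) ≤ 8 * N * A / (3.141592 * D) := div_le_div_of_nonneg_left (by positivity) hπD0 hπD
  have t4a : 4 * Z / (π * D) ≤ 4 * Z₀ / (3.141592 * D) :=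
    (div_le_div_of_nonneg_left (by positivity) hπD0 hπD).trans (div_le_div_of_nonneg_right (by linarith) hπD0.le)
  have t4 : Real.sqrt (4 * Z / (π * D)) ≤ s := Real.sqrt_le_iff.mpr ⟨hs0, t4a.trans hs⟩
  have t5 : 8 * A ^ 2 * Z / π ≤ 8 * A ^ 2 * Z₀ / 3.141592 :=
    (div_le_div_of_nonneg_left (by positivity) hπ0 hπ.le).trans (div_le_div_of_nonneg_right (by nlinarith [sq_nonneg A]) hπ0.le)
  have t45 : c * (8 * N * A ^ 2 * Real.sqrt (4 * Z / (π * D)) + 8 * A ^ 2 * Z / π) ≤ c * (8 * N * A ^ 2 * s + 8 * A ^ 2 * Z₀ / 3.141592) :=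
    mul_le_mul_of_nonneg_left (add_le_add (mul_le_mul_of_nonneg_left t4 (by positivity)) t5) hc
  have hr : 0 ≤ 3 * r ^ 2 := by positivity
  exact mul_le_mul_of_nonneg_left (by linarith) hr

end Summit.AnomalousDissipation.AnomalousDissipation.Theorems.SawtoothPulseCascade.K1Window
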